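import Literature.NumberTheory.EllipticCurves.Kato2004.ZetaIndexInequalitySkeletonProofs
import HarnessLib

/-!
# Kato 2004, §14.14–14.15 when the zeta element lies only in the REFLEXIVE HULL of `𝐇¹(T)`:
# `[H¹(ℤ[1/p],T) : p^e z] ≥ p^e · #H²(ℤ[1/p],T)` from the height-one divisibility for the hull —
# the descent of Thm. 14.5 (3) at a lattice WITH rational `p`-torsion, as module theory over `ℤ_p⟦T⟧`
# (companion of `MainConjectureDescentSkeletonProofs` / `ZetaIndexInequalitySkeletonProofs`)

K. Kato, *`p`-adic Hodge theory and values of zeta functions of modular forms*, Astérisque **295**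
(2004) [Kato2004Asterisque]. In §14.14 (p. 243) the inequality `#H²(ℤ[1/p],T) ≤ [H¹(ℤ[1/p],T) : z]`
of Thm. 14.5 (3) is obtained from (14.14.1) `0 → 𝐇¹(T)/a𝐇¹(T) → H¹(ℤ[1/p],T) → _a𝐇²(T) → 0`,
(14.14.2) `𝐇²(T)/a𝐇²(T) ≅ H²(ℤ[1/p],T)`, Lemma 14.15 and the divisibility of Thm. 12.5 (4), FOR A ZETA
ELEMENT `z ∈ 𝐇¹(T)` (integral by Thm. 12.5 (4) under (12.5.2)). WITHOUT (12.5.2) Kato's Thm. 12.6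
(p. 222: for `T = V_{O_λ}(f)`, "`Z ⊂ Z(f,T)` and `Z(f,T)/Z` is a finite group", `Z ⊂ 𝐇¹(T)` the module
of the integral elements (8.1.3)) only places `z_γ` in the REFLEXIVE HULL `𝐇¹(T)^{**}` of the
torsion-free rank-one module `𝐇¹(T)` (13.14, first two sentences, p. 234: `T = a · V_{O_λ}(f)`, and
the double dual of a finitely generated torsion-free module over the two-dimensional regular local ring
`Λ` is free with finite = pseudo-null cokernel), and Kato's index is then the one of p. 236–237:
"Take `y ∈ M` and a non-zero integer `c` such that `z = c⁻¹y` in `M ⊗ ℚ`. We define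
`[M : z] = [M : O_L y]·[O_L : cO_L]⁻¹`". This file proves, as MODULE THEORY over
`Λ = ℤ_p⟦T⟧ = IwasawaAlgebra p` (Kato's objects as variables, exactly as in the two companion files):

> Let `F` be finitely generated and torsion free (the hull), `j : H ↪ F` a submodule of FINITE index
> (`H = 𝐇¹(T)⁰`, `F/H` pseudo-null), `z ∈ F` non-zero with `F/Λz` torsion, `H2` finitely generated
> torsion (`𝐇²(T)⁰`), `0 → H/TH →ι A →π H2[T] → 0` exact ((14.14.1)), `H2/TH2` finite ((14.14.2) +
> Thm. 14.5 (1)), and `y ∈ H` with `j(y) = p^e · z`. If `ℓ_𝔮(H2) ≤ ℓ_𝔮(F/Λz)` at every height-one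
> prime `𝔮` (the divisibility for the HULL) and `[A : Λ·ι(ȳ)]` is finite, then
> **`[A : Λ·ι(ȳ)] = p^{e+m} · #(H2/TH2)` for some `m ≥ 0`**
> (`Kato2004.exists_index_eq_pow_mul_natCard_coinvariants_of_hull`), i.e. Kato's
> `μ = [A : z]/#H²(ℤ[1/p],T) = [A : y]·p^{−e}/#(H2/TH2) = p^m ≥ 1` with NO defect from the hull index
> `#(F/H)`.

The point: the `Γ`-Euler exponent `e(·)` (tree `IwasawaAlgebra.eulerExp`; Lemma 14.15 at `a = T`)
does not see pseudo-null modules, so `e(H/Λy) = e(F/Λ p^e z) = e(F/Λz) + e·e(Λ/(p)) = e(F/Λz) + e`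
(`e(Λ/(p)) = v_p(p) = 1`), while `#((H/Λy)/T) = p^{e(H/Λy)}` and `#(H2/TH2) = #H2[T]·p^{e(H2)}` as in
the companion files; the divisibility for the hull gives `e(H2) ≤ e(F/Λz)`. Consumer (cell
`bsd-potss`, seat `kmc`): the Kato descent at Kato's member `W_K` (`T_pW_K ≅ V_{O_λ}(f)(1)`) of a
class with REDUCIBLE `E[p]` and `p ∣ #W_K(ℚ)_tors`, where `𝐇¹(T)⁰` need not be free
(`Summits/…/O6/X3KatoMemberBoundOfHullReadings.lean`, the crux `ReducibleKatoMember` of route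
`KatoDescentPotSupersingular`). Theorems only; no definition, no named fact; nothing about Kato's
objects is asserted.

## Contents

* §1 `Kato2004.constVal_eq_one_of_asIdeal_eq_augIdealP` (`v_p(q_{(p)}(0)) = 1`),
  `Kato2004.eulerExp_quotient_C_pow` (`e(Λ/(p^e)) = e`).
* §2 `Kato2004.eulerExp_quotient_span_smul` — change of generator:
  `e(F/Λ(c·z)) = e(F/Λz) + e(Λ/(c))` along `0 → Λz/Λcz ≅ Λ/(c) → F/Λcz → F/Λz → 0`.
* §3 `Kato2004.eulerExp_quotient_span_eq_of_finite_index` — change of module: for `j : H ↪ F` of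
  finite index and `y ∈ H`, `e(H/Λy) = e(F/Λ j(y))` (the cokernel of `H/Λy ↪ F/Λ j(y)` is finite).
* §4 THE HULL DESCENT `Kato2004.exists_index_eq_pow_mul_natCard_coinvariants_of_hull` and its
  divisibility / valuation forms.

References: [Kato2004Asterisque] Thm. 12.4 (p. 221), Thm. 12.5 (3)–(4) (p. 222), Thm. 12.6
(p. 222), 13.14 (p. 234), Thm. 14.5 and the index `[M : z]` (pp. 236–237), §14.14 (14.14.1)–(14.14.2)
and Lemma 14.15 (pp. 243–244). The reflexive hull: [BourbakiAC5to7] Ch. VII §4 no. 2; the `Γ`-Euler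
characteristic: [GreenbergLNM1716] §4 Lemma 4.2, [Washington1997] §13.2.
-/

noncomputable section

open scoped Classical

universe u

namespace Literature.NumberTheory.EllipticCurves.Kato2004

open Literature.NumberTheory.EllipticCurves.IwasawaAlgebra

variable {p : ℕ} [Fact p.Prime]

/-! ### §1 The height-one prime `(p)`: `v_p(q_{(p)}(0)) = 1` and `e(Λ/(p^e)) = e` -/

/-- The height-one prime `(p)` of `Λ` is not `(T)` (`T ∉ (p)`: its degree-one coefficient is `1`).
[cite: Washington1997, §13.2] -/
theorem ne_primeT_of_asIdeal_eq_augIdealP (𝔭 : PrimeSpectrum (IwasawaAlgebra p))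
    (h𝔭 : 𝔭.asIdeal = augIdealP p) : 𝔭 ≠ primeT p := by
  intro h
  have hX : (PowerSeries.X : IwasawaAlgebra p) ∈ 𝔭.asIdeal := by
    rw [h, primeT_asIdeal]
    exact Ideal.mem_span_singleton_self _
  rw [h𝔭, mem_augIdealP_iff] at hX
  have h1 := hX 1
  rw [PowerSeries.coeff_one_X] at h1
  exact (PadicInt.irreducible_p (p := p)).not_isUnit (isUnit_of_dvd_one h1)

/-- `(p)` lies in the index set of the `Γ`-Euler exponent (height one, `≠ (T)`).
[cite: Washington1997, §13.2] -/
theorem mem_heightOneNeT_of_asIdeal_eq_augIdealP (𝔭 : PrimeSpectrum (IwasawaAlgebra p))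
    (h𝔭 : 𝔭.asIdeal = augIdealP p) : 𝔭 ∈ heightOneNeT p :=
  ⟨by rw [h𝔭]; exact height_augIdealP_holds p, ne_primeT_of_asIdeal_eq_augIdealP 𝔭 h𝔭⟩

/-- **`v_p(q_{(p)}(0)) = 1`**: the chosen generator of the height-one prime `(p) ⊂ ℤ_p⟦T⟧` is a unit
multiple of `p`, so its constant term has `p`-adic valuation one (`#Λ/(q, T) = #ℤ_p/(p) = p`).
[cite: Washington1997, §13.2] -/
theorem constVal_eq_one_of_asIdeal_eq_augIdealP (𝔭 : PrimeSpectrum (IwasawaAlgebra p))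
    (h𝔭 : 𝔭.asIdeal = augIdealP p) : constVal p 𝔭 = 1 := by
  have hht : 𝔭.asIdeal.height = 1 := by rw [h𝔭]; exact height_augIdealP_holds p
  have hspan : Ideal.span {primeGen p 𝔭} = Ideal.span {PowerSeries.C (p : ℤ_[p])} := by
    rw [span_primeGen hht, h𝔭, augIdealP]
  obtain ⟨u, hu⟩ := Ideal.span_singleton_eq_span_singleton.mp hspan
  have h := congrArg PowerSeries.constantCoeff hu
  rw [map_mul, PowerSeries.constantCoeff_C] at h
  have hp0 : (p : ℤ_[p]) ≠ 0 := by exact_mod_cast (Fact.out : p.Prime).ne_zero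
  have hcu : IsUnit (PowerSeries.constantCoeff (u : IwasawaAlgebra p)) :=
    PowerSeries.isUnit_iff_constantCoeff.mp u.isUnit
  have hb : PowerSeries.constantCoeff (u : IwasawaAlgebra p) ≠ 0 := hcu.ne_zero
  have ha : PowerSeries.constantCoeff (primeGen p 𝔭) ≠ 0 := by
    intro h0
    rw [h0, zero_mul] at h
    exact hp0 h.symm
  have hval := congrArg PadicInt.valuation h
  rw [PadicInt.valuation_mul ha hb, PadicInt.valuation_p] at hval
  have hu0 : (PowerSeries.constantCoeff (u : IwasawaAlgebra p)).valuation = 0 := by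
    obtain ⟨v, hv⟩ := hcu
    have h1 := congrArg PadicInt.valuation v.mul_inv
    rw [PadicInt.valuation_mul v.ne_zero (v⁻¹).ne_zero, PadicInt.valuation_one] at h1
    rw [← hv]
    omega
  unfold constVal
  omega

/-- **`e(Λ/(p^e)) = e`**: the cyclic module `Λ/(p^e)` has local length `e` at `(p)` and `0` at every
other height-one prime, and `v_p(q_{(p)}(0)) = 1` (its `Γ`-Euler characteristic:
`#Λ/(p^e, T) = p^e`, `(Λ/(p^e))[T] = 0`). [cite: Washington1997, §13.2] [cite: GreenbergLNM1716, §4 Lemma 4.2] -/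
theorem eulerExp_quotient_C_pow (e : ℕ) :
    eulerExp p (IwasawaAlgebra p ⧸ Ideal.span {PowerSeries.C ((p : ℤ_[p]) ^ e)}) = e := by
  let 𝔭 : PrimeSpectrum (IwasawaAlgebra p) := ⟨augIdealP p, isPrime_augIdealP_holds p⟩
  have h𝔭 : 𝔭 ∈ heightOneNeT p := mem_heightOneNeT_of_asIdeal_eq_augIdealP 𝔭 rfl
  -- the summand at a height-one `𝔮 ≠ (p)` vanishes, at `(p)` it is `e`
  have hterm : ∀ 𝔮 ∈ heightOneNeT p,
      (Module.lengthAt (IwasawaAlgebra p)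
          (IwasawaAlgebra p ⧸ Ideal.span {PowerSeries.C ((p : ℤ_[p]) ^ e)}) 𝔮).toNat *
        constVal p 𝔮 = if 𝔮 = 𝔭 then e else 0 := by
    intro 𝔮 h𝔮
    rw [lengthAt_quotient_C_pow e 𝔮 h𝔮.1]
    by_cases hmem : PowerSeries.C (p : ℤ_[p]) ∈ 𝔮.asIdeal
    · have hle : 𝔭.asIdeal ≤ 𝔮.asIdeal := by
        change augIdealP p ≤ 𝔮.asIdeal
        rw [augIdealP, Ideal.span_singleton_le_iff_mem]
        exact hmem
      have heq : 𝔭 = 𝔮 := eq_of_height_eq_one_of_le h𝔭.1 h𝔮.1 hle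
      subst heq
      rw [if_pos hmem, if_pos rfl, constVal_eq_one_of_asIdeal_eq_augIdealP 𝔭 rfl, mul_one,
        nsmul_eq_mul, mul_one, ENat.toNat_coe]
    · have hne : 𝔮 ≠ 𝔭 := by
        rintro rfl
        exact hmem (by
          change PowerSeries.C (p : ℤ_[p]) ∈ augIdealP p
          exact Ideal.mem_span_singleton_self _)
      rw [if_neg hmem, if_neg hne, smul_zero, ENat.toNat_zero, zero_mul]
  unfold eulerExp
  rw [finsum_mem_congr rfl hterm, finsum_mem_def, finsum_eq_single _ 𝔭]
  · rw [Set.indicator_of_mem h𝔭, if_pos rfl]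
  · intro 𝔮 hne
    rw [Set.indicator_apply_eq_zero]
    intro _
    rw [if_neg hne]

/-! ### §2 Change of generator: `e(F/Λ(c·z)) = e(F/Λz) + e(Λ/(c))` -/

section Generator

variable {F : Type u} [AddCommGroup F] [Module (IwasawaAlgebra p) F]
  [Module.Finite (IwasawaAlgebra p) F] [NoZeroSMulDivisors (IwasawaAlgebra p) F]

omit [Module.Finite (IwasawaAlgebra p) F] [NoZeroSMulDivisors (IwasawaAlgebra p) F] in
/-- `F/Λ(c·z)` is torsion when `F/Λz` is and `c ≠ 0` (private helper). [folklore] -/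
private theorem isTorsion_quotient_span_smul {c : IwasawaAlgebra p} (hc : c ≠ 0) (z : F)
    (hFZ : Module.IsTorsion (IwasawaAlgebra p) (F ⧸ (IwasawaAlgebra p) ∙ z)) :
    Module.IsTorsion (IwasawaAlgebra p) (F ⧸ (IwasawaAlgebra p) ∙ (c • z)) := by
  intro q
  induction q using Submodule.Quotient.induction_on with
  | H x =>
    obtain ⟨a, ha⟩ := @hFZ (Submodule.Quotient.mk x)
    rw [Submonoid.smul_def, ← Submodule.Quotient.mk_smul, Submodule.Quotient.mk_eq_zero,
      Submodule.mem_span_singleton] at ha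
    obtain ⟨b, hb⟩ := ha
    refine ⟨⟨c * (a : IwasawaAlgebra p),
      mul_mem (mem_nonZeroDivisors_of_ne_zero hc) a.2⟩, ?_⟩
    rw [Submonoid.smul_def]
    change (c * (a : IwasawaAlgebra p)) • Submodule.Quotient.mk x = 0
    rw [← Submodule.Quotient.mk_smul, Submodule.Quotient.mk_eq_zero, Submodule.mem_span_singleton]
    exact ⟨b, by rw [mul_smul, ← hb, smul_comm]⟩

/-- **Change of generator**: for `F` finitely generated torsion free, `z ∈ F` non-zero with `F/Λz`
torsion and `c ≠ 0`, `e(F/Λ(c·z)) = e(F/Λz) + e(Λ/(c))` — the `Γ`-Euler exponent along the exact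
sequence `0 → Λz/Λcz → F/Λcz → F/Λz → 0`, where `Λz/Λcz ≅ Λ/(c)` (`z` is torsion free).
[cite: Kato2004Asterisque, definition of `[M : z]` (pp. 236–237)] [cite: GreenbergLNM1716, §4 Lemma 4.2] -/
theorem eulerExp_quotient_span_smul {c : IwasawaAlgebra p} (hc : c ≠ 0) (z : F) (hz : z ≠ 0)
    (hFZ : Module.IsTorsion (IwasawaAlgebra p) (F ⧸ (IwasawaAlgebra p) ∙ z)) :
    eulerExp p (F ⧸ (IwasawaAlgebra p) ∙ (c • z)) =
      eulerExp p (F ⧸ (IwasawaAlgebra p) ∙ z) + eulerExp p (IwasawaAlgebra p ⧸ Ideal.span {c}) := by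
  set Zc : Submodule (IwasawaAlgebra p) F := (IwasawaAlgebra p) ∙ (c • z) with hZc
  set Z : Submodule (IwasawaAlgebra p) F := (IwasawaAlgebra p) ∙ z with hZ
  have hle : Zc ≤ Z := by
    rw [hZc, Submodule.span_singleton_le_iff_mem]
    exact Submodule.smul_mem _ c (Submodule.mem_span_singleton_self z)
  -- the image `M' = Λ·z̄` of `Λz` in `F/Λcz`
  set M' : Submodule (IwasawaAlgebra p) (F ⧸ Zc) := Z.map Zc.mkQ with hM'
  -- `M' ≅ Λ/(c)` via `a ↦ a·z̄`
  set φ : IwasawaAlgebra p →ₗ[IwasawaAlgebra p] F ⧸ Zc :=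
    Zc.mkQ.comp (LinearMap.toSpanSingleton (IwasawaAlgebra p) F z) with hφ
  have hrange : LinearMap.range φ = M' := by
    rw [hφ, LinearMap.range_comp, ← LinearMap.span_singleton_eq_range, hM', hZ]
  have hker : LinearMap.ker φ = Ideal.span {c} := by
    ext a
    rw [LinearMap.mem_ker, hφ, LinearMap.comp_apply, LinearMap.toSpanSingleton_apply,
      Submodule.mkQ_apply, Submodule.Quotient.mk_eq_zero, hZc, Submodule.mem_span_singleton,
      Ideal.mem_span_singleton']
    constructor
    · rintro ⟨b, hb⟩
      refine ⟨b, ?_⟩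
      have h0 : (b * c - a) • z = 0 := by rw [sub_smul, mul_smul, hb, sub_self]
      rcases smul_eq_zero.mp h0 with h0 | h0
      · exact (sub_eq_zero.mp h0)
      · exact absurd h0 hz
    · rintro ⟨b, rfl⟩
      exact ⟨b, by rw [mul_smul]⟩
  have eM' : (IwasawaAlgebra p ⧸ Ideal.span {c}) ≃ₗ[IwasawaAlgebra p] M' :=
    ((Submodule.quotEquivOfEq _ _ hker).symm.trans φ.quotKerEquivRange).trans
      (LinearEquiv.ofEq _ _ hrange)
  -- the quotient map `F/Λcz → F/Λz`, kernel `M'`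
  set ψ : (F ⧸ Zc) →ₗ[IwasawaAlgebra p] F ⧸ Z := Submodule.factor hle with hψ
  have hψ_surj : Function.Surjective ψ := by
    intro q
    obtain ⟨x, rfl⟩ := Submodule.Quotient.mk_surjective _ q
    exact ⟨Submodule.Quotient.mk x, rfl⟩
  have hkerψ : LinearMap.ker ψ = M' := by
    ext q
    induction q using Submodule.Quotient.induction_on with
    | H x =>
      rw [LinearMap.mem_ker]
      change Submodule.Quotient.mk (p := Z) x = 0 ↔ _
      rw [Submodule.Quotient.mk_eq_zero, hM']
      constructor
      · intro hx
        exact ⟨x, hx, rfl⟩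
      · rintro ⟨x', hx', hxx'⟩
        rw [Submodule.mkQ_apply, Submodule.Quotient.eq] at hxx'
        have : x = x' - (x' - x) := by abel
        rw [this]
        exact Z.sub_mem hx' (hle hxx')
  have hex : Function.Exact M'.subtype ψ := by
    rw [LinearMap.exact_iff, hkerψ, Submodule.range_subtype]
  have htors : Module.IsTorsion (IwasawaAlgebra p) (F ⧸ Zc) :=
    isTorsion_quotient_span_smul hc z hFZ
  rw [eulerExp_eq_add_of_exact htors M'.subtype ψ (Submodule.subtype_injective _) hψ_surj hex,
    ← eulerExp_eq_of_linearEquiv eM', add_comm]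

end Generator

/-! ### §3 Change of module along a finite-index inclusion: `e(H/Λy) = e(F/Λ j(y))` -/

section FiniteIndex

variable {F H : Type u} [AddCommGroup F] [Module (IwasawaAlgebra p) F]
  [AddCommGroup H] [Module (IwasawaAlgebra p) H] [Module.Finite (IwasawaAlgebra p) F]

/-- **Pseudo-null modules are invisible to `e(·)`**: for an injection `j : H ↪ F` with FINITE
cokernel `F/j(H)` and `y ∈ H` with `F/Λ j(y)` torsion, the induced map `H/Λy ↪ F/Λ j(y)` is
injective with finite cokernel, so `H/Λy` is torsion and `e(H/Λy) = e(F/Λ j(y))` (finite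
`Λ`-modules have no support in height `≤ 1`). This is where the hull index `#(𝐇¹(T)^{**}/𝐇¹(T))`
drops out of Kato's §14.14 count. [cite: Kato2004Asterisque, 13.14 (p. 234) and Lemma 14.15 (p. 244)] [cite: BourbakiAC5to7, Ch. VII §4 no. 2] -/
theorem eulerExp_quotient_span_eq_of_finite_index (j : H →ₗ[IwasawaAlgebra p] F)
    (hj : Function.Injective j) (hcok : Finite (F ⧸ LinearMap.range j)) (y : H)
    (hFy : Module.IsTorsion (IwasawaAlgebra p) (F ⧸ (IwasawaAlgebra p) ∙ j y)) :
    Module.IsTorsion (IwasawaAlgebra p) (H ⧸ (IwasawaAlgebra p) ∙ y) ∧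
      eulerExp p (H ⧸ (IwasawaAlgebra p) ∙ y) = eulerExp p (F ⧸ (IwasawaAlgebra p) ∙ j y) := by
  set Y : Submodule (IwasawaAlgebra p) H := (IwasawaAlgebra p) ∙ y with hY
  set W : Submodule (IwasawaAlgebra p) F := (IwasawaAlgebra p) ∙ j y with hW
  have hmap : Y.map j = W := by rw [hY, hW, Submodule.map_span, Set.image_singleton]
  have hcomap : Y ≤ W.comap j := by rw [← hmap]; exact Submodule.le_comap_map _ _
  set θ : (H ⧸ Y) →ₗ[IwasawaAlgebra p] F ⧸ W := Submodule.mapQ Y W j hcomap with hθ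
  -- `θ` is injective: `comap j W = Y` as `j` is injective
  have hθ_inj : Function.Injective θ := by
    rw [← LinearMap.ker_eq_bot, hθ, Submodule.mapQ, Submodule.ker_liftQ, LinearMap.ker_comp,
      Submodule.ker_mkQ, ← hmap, Submodule.comap_map_eq, LinearMap.ker_eq_bot.mpr hj, sup_bot_eq,
      Submodule.mkQ_map_self]
  -- its cokernel is a quotient of `F/j(H)`, hence finite
  set C := (F ⧸ W) ⧸ LinearMap.range θ with hC
  have hsurj : Function.Surjective
      ((LinearMap.range j).liftQ ((LinearMap.range θ).mkQ.comp W.mkQ) (by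
        rintro _ ⟨h, rfl⟩
        rw [LinearMap.mem_ker, LinearMap.comp_apply, Submodule.mkQ_apply, Submodule.mkQ_apply,
          Submodule.Quotient.mk_eq_zero]
        exact ⟨Submodule.Quotient.mk h, by rw [hθ, Submodule.mapQ_apply]⟩)) := by
    intro q
    obtain ⟨q', rfl⟩ := Submodule.Quotient.mk_surjective _ q
    obtain ⟨x, rfl⟩ := Submodule.Quotient.mk_surjective _ q'
    exact ⟨Submodule.Quotient.mk x, rfl⟩
  haveI : Finite C := Finite.of_surjective _ hsurj
  have hex : Function.Exact θ (LinearMap.range θ).mkQ := LinearMap.exact_map_mkQ_range θ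
  refine ⟨isTorsion_of_injective θ hθ_inj hFy, ?_⟩
  rw [eulerExp_eq_add_of_exact hFy θ (LinearMap.range θ).mkQ hθ_inj (Submodule.mkQ_surjective _)
    hex, eulerExp_eq_zero_of_finite C, add_zero]

end FiniteIndex

/-! ### §4 THE HULL DESCENT: `[A : Λ·ι(ȳ)] = p^{e+m} · #(H2/TH2)` for `j(y) = p^e z`, `z` in the hull -/

section Hull

variable {F H H2 A : Type u} [AddCommGroup F] [Module (IwasawaAlgebra p) F]
  [AddCommGroup H] [Module (IwasawaAlgebra p) H] [AddCommGroup H2] [Module (IwasawaAlgebra p) H2]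
  [AddCommGroup A] [Module (IwasawaAlgebra p) A]
  [Module.Finite (IwasawaAlgebra p) F] [NoZeroSMulDivisors (IwasawaAlgebra p) F]
  [Module.Finite (IwasawaAlgebra p) H] [NoZeroSMulDivisors (IwasawaAlgebra p) H]
  [Module.Finite (IwasawaAlgebra p) H2]

/-- **THE HULL DESCENT (Kato §14.14–14.15 at a lattice whose zeta element is only in the reflexive
hull; Thm. 12.6 + 13.14 in place of Thm. 12.5 (4)).** Over `Λ = ℤ_p⟦T⟧`: `F` finitely generated
torsion free (`𝐇¹(T)^{**}`), `j : H ↪ F` of finite index (`H = 𝐇¹(T)`, Thm. 12.4 (2); the hull of a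
torsion-free module over the two-dimensional regular local ring has pseudo-null = finite cokernel),
`z ∈ F` non-zero with `F/Λz` torsion (the zeta element, rank one), `H2` finitely generated torsion
(`𝐇²(T)`, Thm. 12.4 (1)) with **`ℓ_𝔮(H2) ≤ ℓ_𝔮(F/Λz)` at every height-one `𝔮`** (the divisibility for
the hull: off `(p)` this is Thm. 12.5 (3), image-free; at `(p)` it is `μ(𝐇²) = 0`, a hypothesis of the
consumer), `0 → H/TH →ι A →π H2[T] → 0` exact ((14.14.1), `A = H¹(ℤ[1/p],T)`), `H2/TH2` finite
((14.14.2), Thm. 14.5 (1)), `y ∈ H` with `j(y) = p^e·z` (Kato p. 236: "`z = c⁻¹y`", `c = p^e`) and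
`[A : Λ·ι(ȳ)] ≠ 0` (the zeta element survives at the bottom layer). Then
**`[A : Λ·ι(ȳ)] = p^{e+m} · #(H2/TH2)` for some `m ≥ 0`** — Kato's
`μ = [A : z]·#H²(ℤ[1/p],T)⁻¹ = [A : y]·p^{−e}·#(H2/TH2)⁻¹ = p^m ≥ 1`, with NO contribution of the hull
index `#(F/H)`: `[A : Λ·ι ȳ] = #H2[T]·#((H/Λy)/T)`, `#((H/Λy)/T) = p^{e(H/Λy)}` (`(H/Λy)[T] = 0`),
`e(H/Λy) = e(F/Λ p^e z) = e(F/Λz) + e`, `#(H2/TH2) = #H2[T]·p^{e(H2)}`, `e(H2) ≤ e(F/Λz)`. Module theory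
only; nothing about Kato's objects is asserted.
[cite: Kato2004Asterisque, Thm. 12.6 (p. 222), 13.14 (p. 234), Thm. 14.5 (3) and `[M : z]` (pp. 236–237), §14.14 (14.14.1)–(14.14.2) and Lemma 14.15 (pp. 243–244)] -/
theorem exists_index_eq_pow_mul_natCard_coinvariants_of_hull (j : H →ₗ[IwasawaAlgebra p] F)
    (hj : Function.Injective j) (hcok : Finite (F ⧸ LinearMap.range j)) (z : F) (hz : z ≠ 0)
    (hFZ : Module.IsTorsion (IwasawaAlgebra p) (F ⧸ (IwasawaAlgebra p) ∙ z))
    (hH2 : Module.IsTorsion (IwasawaAlgebra p) H2)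
    (hdiv : ∀ 𝔮 : PrimeSpectrum (IwasawaAlgebra p), 𝔮.asIdeal.height = 1 →
      Module.lengthAt (IwasawaAlgebra p) H2 𝔮 ≤
        Module.lengthAt (IwasawaAlgebra p) (F ⧸ (IwasawaAlgebra p) ∙ z) 𝔮)
    (y : H) (e : ℕ) (hy : j y = PowerSeries.C ((p : ℤ_[p]) ^ e) • z)
    (ι : coinvariants p H →ₗ[IwasawaAlgebra p] A) (π : A →ₗ[IwasawaAlgebra p] invariants p H2)
    (hι : Function.Injective ι) (hπ : Function.Surjective π) (hex : Function.Exact ι π)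
    (hfin : Finite (coinvariants p H2))
    (hne : Nat.card (A ⧸ (IwasawaAlgebra p) ∙ ι (Submodule.Quotient.mk y)) ≠ 0) :
    ∃ m : ℕ, Nat.card (A ⧸ (IwasawaAlgebra p) ∙ ι (Submodule.Quotient.mk y)) =
      p ^ (e + m) * Nat.card (coinvariants p H2) := by
  have hp0 : (p : ℤ_[p]) ≠ 0 := by exact_mod_cast (Fact.out : p.Prime).ne_zero
  have hc : PowerSeries.C ((p : ℤ_[p]) ^ e) ≠ (0 : IwasawaAlgebra p) := by
    rw [Ne, ← map_zero (PowerSeries.C (R := ℤ_[p])), PowerSeries.C_injective.eq_iff]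
    exact pow_ne_zero _ hp0
  -- `y ≠ 0`
  have hy0 : y ≠ 0 := by
    rintro rfl
    rw [map_zero] at hy
    rcases smul_eq_zero.mp hy.symm with h | h
    · exact hc h
    · exact hz h
  -- torsion and Euler exponents of the quotients by the zeta lines
  have hFcz : Module.IsTorsion (IwasawaAlgebra p)
      (F ⧸ (IwasawaAlgebra p) ∙ (PowerSeries.C ((p : ℤ_[p]) ^ e) • z)) :=
    isTorsion_quotient_span_smul hc z hFZ
  have hFy : Module.IsTorsion (IwasawaAlgebra p) (F ⧸ (IwasawaAlgebra p) ∙ j y) := by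
    rw [hy]; exact hFcz
  obtain ⟨hHy, heHF⟩ := eulerExp_quotient_span_eq_of_finite_index j hj hcok y hFy
  have heF : eulerExp p (F ⧸ (IwasawaAlgebra p) ∙ j y) =
      eulerExp p (F ⧸ (IwasawaAlgebra p) ∙ z) + e := by
    rw [hy, eulerExp_quotient_span_smul hc z hz hFZ, eulerExp_quotient_C_pow]
  have hle : eulerExp p H2 ≤ eulerExp p (F ⧸ (IwasawaAlgebra p) ∙ z) :=
    eulerExp_le_of_lengthAt_le hH2 hFZ hdiv
  -- the counts
  set Q := H ⧸ (IwasawaAlgebra p) ∙ y with hQ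
  obtain ⟨-, hcard2⟩ := natCard_coinvariants_eq_of_finite H2 hH2 hfin
  have hA : Nat.card (A ⧸ (IwasawaAlgebra p) ∙ ι (Submodule.Quotient.mk y)) =
      Nat.card (invariants p H2) * Nat.card (coinvariants p Q) := by
    rw [natCard_quotient_eq_of_exact ι π hι hπ hex, ← natCard_coinvariants_quotient_span y]
  have hneQ : Nat.card (coinvariants p Q) ≠ 0 := by
    intro h0
    rw [h0, mul_zero] at hA
    exact hne hA
  have hfinQ : Finite (coinvariants p Q) := Nat.finite_of_card_ne_zero hneQ
  have hTQ : Module.lengthAt (IwasawaAlgebra p) Q (primeT p) = 0 :=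
    lengthAt_primeT_eq_zero_of_finite_coinvariants Q hHy hfinQ
  obtain ⟨hfinQT, -, hcardQ⟩ := card_coinvariants_of_lengthAt_eq_zero Q hHy hTQ
  rw [natCard_invariants_quotient_span_eq_one y hy0 hfinQT, one_mul] at hcardQ
  refine ⟨eulerExp p (F ⧸ (IwasawaAlgebra p) ∙ z) - eulerExp p H2, ?_⟩
  rw [hA, hcardQ, heHF, heF, hcard2]
  have : eulerExp p (F ⧸ (IwasawaAlgebra p) ∙ z) + e =
      eulerExp p H2 + (e + (eulerExp p (F ⧸ (IwasawaAlgebra p) ∙ z) - eulerExp p H2)) := by omega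
  rw [this, pow_add]
  ring

/-- **Divisibility form of the hull descent: `p^e · #(H2/TH2) ∣ [A : Λ·ι(ȳ)]`** (Kato's `μ ≥ 1` at a
lattice whose zeta element is only in the hull). [cite: Kato2004Asterisque, Thm. 14.5 (3) (p. 236), §14.14 (p. 243)] -/
theorem pow_mul_natCard_coinvariants_dvd_index_of_hull (j : H →ₗ[IwasawaAlgebra p] F)
    (hj : Function.Injective j) (hcok : Finite (F ⧸ LinearMap.range j)) (z : F) (hz : z ≠ 0)
    (hFZ : Module.IsTorsion (IwasawaAlgebra p) (F ⧸ (IwasawaAlgebra p) ∙ z))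
    (hH2 : Module.IsTorsion (IwasawaAlgebra p) H2)
    (hdiv : ∀ 𝔮 : PrimeSpectrum (IwasawaAlgebra p), 𝔮.asIdeal.height = 1 →
      Module.lengthAt (IwasawaAlgebra p) H2 𝔮 ≤
        Module.lengthAt (IwasawaAlgebra p) (F ⧸ (IwasawaAlgebra p) ∙ z) 𝔮)
    (y : H) (e : ℕ) (hy : j y = PowerSeries.C ((p : ℤ_[p]) ^ e) • z)
    (ι : coinvariants p H →ₗ[IwasawaAlgebra p] A) (π : A →ₗ[IwasawaAlgebra p] invariants p H2)
    (hι : Function.Injective ι) (hπ : Function.Surjective π) (hex : Function.Exact ι π)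
    (hfin : Finite (coinvariants p H2))
    (hne : Nat.card (A ⧸ (IwasawaAlgebra p) ∙ ι (Submodule.Quotient.mk y)) ≠ 0) :
    p ^ e * Nat.card (coinvariants p H2) ∣
      Nat.card (A ⧸ (IwasawaAlgebra p) ∙ ι (Submodule.Quotient.mk y)) := by
  obtain ⟨m, hm⟩ := exists_index_eq_pow_mul_natCard_coinvariants_of_hull j hj hcok z hz hFZ hH2 hdiv
    y e hy ι π hι hπ hex hfin hne
  rw [hm, pow_add, mul_assoc, mul_comm (p ^ m), ← mul_assoc]
  exact Dvd.intro _ rfl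

/-- **Valuation form of the hull descent: `e + ord_p #(H2/TH2) ≤ ord_p [A : Λ·ι(ȳ)]`**, i.e.
`ord_p [A : z] ≥ ord_p #H²(ℤ[1/p],T)` for Kato's index `[A : z] = [A : y]·p^{−e}` (p. 236).
[cite: Kato2004Asterisque, Thm. 14.5 (3) and `[M : z]` (pp. 236–237), §14.14 (p. 243)] -/
theorem padicValNat_natCard_coinvariants_add_le_of_hull (j : H →ₗ[IwasawaAlgebra p] F)
    (hj : Function.Injective j) (hcok : Finite (F ⧸ LinearMap.range j)) (z : F) (hz : z ≠ 0)
    (hFZ : Module.IsTorsion (IwasawaAlgebra p) (F ⧸ (IwasawaAlgebra p) ∙ z))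
    (hH2 : Module.IsTorsion (IwasawaAlgebra p) H2)
    (hdiv : ∀ 𝔮 : PrimeSpectrum (IwasawaAlgebra p), 𝔮.asIdeal.height = 1 →
      Module.lengthAt (IwasawaAlgebra p) H2 𝔮 ≤
        Module.lengthAt (IwasawaAlgebra p) (F ⧸ (IwasawaAlgebra p) ∙ z) 𝔮)
    (y : H) (e : ℕ) (hy : j y = PowerSeries.C ((p : ℤ_[p]) ^ e) • z)
    (ι : coinvariants p H →ₗ[IwasawaAlgebra p] A) (π : A →ₗ[IwasawaAlgebra p] invariants p H2)
    (hι : Function.Injective ι) (hπ : Function.Surjective π) (hex : Function.Exact ι π)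
    (hfin : Finite (coinvariants p H2))
    (hne : Nat.card (A ⧸ (IwasawaAlgebra p) ∙ ι (Submodule.Quotient.mk y)) ≠ 0) :
    e + padicValNat p (Nat.card (coinvariants p H2)) ≤
      padicValNat p (Nat.card (A ⧸ (IwasawaAlgebra p) ∙ ι (Submodule.Quotient.mk y))) := by
  haveI := hfin
  obtain ⟨m, hm⟩ := exists_index_eq_pow_mul_natCard_coinvariants_of_hull j hj hcok z hz hFZ hH2 hdiv
    y e hy ι π hι hπ hex hfin hne
  have h2 : Nat.card (coinvariants p H2) ≠ 0 := (Nat.card_pos (α := coinvariants p H2)).ne'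
  rw [hm, padicValNat.mul (pow_ne_zero _ (Fact.out : p.Prime).ne_zero) h2, padicValNat.prime_pow]
  omega

end Hull

end Literature.NumberTheory.EllipticCurves.Kato2004

end
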